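/-
Copyright (c) 2026 the pub-hodgecm-mathlib formalisation cell (harness21).  Prover seat hodgecm-mathlib-LH10-p02 (g14), 2026-09-03.  E1 row 55 «HOROCYCLE ∕ HEIGHT
GEOMETRY OF THE U(3) TREE AT THE DATUM», file B-2 «THE HOROCYCLE DATA OF ★ 5b AT THE DATUM, ASSEMBLED» (keeper F0P3a-p03 (g30); consumer census `CENSUS-R61.v1` §2 (X1)(X2)).
-/
import Summits.HodgeConjecture.HodgeConjecture.Theorems.F0P3cStCharTSHorocyclesAtDatum   -- ★ B-1 (this seat): transport, (X0) `τ`, `T ∩ Stab(A 0)`, (X1v)(X1e) horocycle index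
import HarnessLib

/-!
# F0 · P3c · E1 row 55 — THE BLOCK-PERMUTATION ∕ HOROCYCLE LETTERS OF ★ 5b `Representation.sum_finrank_block_eigen_eq_of_tree` AT THE CM DATUM, ASSEMBLED
# (`R₀ = A(ℤ)`, `R₁ = {A j, A (j+1)}(ℤ)`, `rep = A ∘ idx`, `ht = idx ∕ 2`, `τM · A j = A (j+2)`, `C = T ∩ Stab(A 0)`, `S₀ = {A 0, A 1}`, `S₁ = {e₀, e₁}`)

Cell `pub/hodgecm-mathlib`, crux H413 = `stmt-HodgeConjecture-24833` (`--supports` lane, helper, THEOREMS ONLY: no definition ∕ instance ∕ notation ∕ named fact ∕ `sorry`).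
Namespace `Summit.HodgeConjecture.HodgeConjecture.Cruxes.H413.F0P3cStCharTSHorocyclesAtDatum` (continued).  E1 BRICK LEDGER row 55 (keeper F0P3a-p03 (g30)), file B-2 of the datum
side; letters and currency as ★ B-1 (`Γ := Gqs L v`, `t := cmBorelTriple L 3 v` spelt `(cmBorelTriple L 3 v : ParabolicTriple (Gqs L v))`, `a g = latticeGraphIso σ_w ϖ J₀ (eA g)`,
apartment `(A, hA0, hA1)` hypothesis-style).  Consumer: row 61b (F0P2-p06 (g22)) = the discharge of the horocycle binders of ★ 5b ∕ ★ HEAD v2 at the datum.  HONEST LABEL: count-neutral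
datum helper ((R-SS) banked as a PAYDOWN-UNR road for K1 only; E1 = PRINT); HC_CM is proved only modulo the 7 printed citations (2 remaining named inputs hLiu418 =
`stmt-HodgeConjecture-24832`, h413 = `stmt-HodgeConjecture-24833`) until rung 0 closes.

* `exists_horocycleData_vertices (P₀) (hP₀ : g ∈ P₀ ↔ a g (A 0) = A 0) (τM) (hτA : ∀ j, a τM (A j) = A (j+2))` — the VERTEX letters `rep₀ tr₀ htrN₀ hrepR₀ htr₀ hrep_act₀ hrep_id₀ ht₀
  hsh₀ hsh₀' hCR₀` of ★ 5b with `R₀ := Set.range A`, plus `hS₀` in the form `(r ∈ R₀ ∧ ht₀ r = 0) ↔ (r = A 0 ∨ r = A 1)`.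
* `exists_horocycleData_edges` — the EDGE letters (`act₁ g := (a g).mapEdgeSet`, `R₁ := Set.range (j ↦ {A j, A (j+1)})`), `hS₁` as `(r ∈ R₁ ∧ ht₁ r = 0) ↔ (r = e₀ ∨ r = e₁)`.
(`τM hτM` = ★ B-1 (X0); `hCM` = `inf_le_left`; `hCτ` = ★ B-1 `mul_comm_of_mem_cmBorelTriple_M`; `hC` = ★ B-1 `isCompact_cmBorelTriple_M_inf`; `hN` = ★ `isLimitOfCompactOpen_cmBorelTriple_N`.)

## References
* [BruhatTits1972] F. Bruhat, J. Tits, *Groupes réductifs sur un corps local I*, Publ. Math. IHÉS 41 (1972), §10.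
* [Serre1980Trees] J.-P. Serre, *Trees* (1980), Ch. II §1.1, Ch. I §6.4.
* [Rogawski1990] J. D. Rogawski, *Automorphic Representations of Unitary Groups in Three Variables*, Ann. of Math. Stud. 123 (1990), §1.10 p. 9, §4.5 p. 45.
* [Casselman1995] W. Casselman, *Introduction to the theory of admissible representations of p-adic reductive groups* (1995), §6.3 (Jacquet modules of `P`-orbit filtrations).
-/

set_option autoImplicit false
-- the mandated namespace has the single-problem summit's repeated segment (`HodgeConjecture.HodgeConjecture`)
set_option linter.dupNamespace false

noncomputable section

open NumberField IsDedekindDomain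
open scoped Valued WithZero Matrix MatrixGroups
open Literature.NumberTheory.Rogawski1990 Literature.NumberTheory.Automorphic Literature.NumberTheory.Automorphic.UnitaryGroup
open Literature.NumberTheory.Automorphic.UnitaryLatticeTree Literature.NumberTheory.Automorphic.HermitianLattice

namespace Summit.HodgeConjecture.HodgeConjecture.Cruxes.H413.F0P3cStCharTSHorocyclesAtDatum

/-! ## §4 THE ASSEMBLED BLOCK-PERMUTATION LETTERS OF ★ 5b `sum_finrank_block_eigen_eq_of_tree` AT THE DATUM (`R₀ = A(ℤ)`, `R₁ = {A j, A (j+1)}(ℤ)`, `rep = A ∘ idx`, `ht = idx ∕ 2`,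
`τM = τ`, `C = T ∩ Stab(A 0)`, `S₀ = {A 0, A 1}`, `S₁ = {e₀, e₁}`) -/

section Package

variable (L : Type) [Field L] [NumberField L] [IsCMField L] (v : HeightOneSpectrum (𝓞 ↥(maximalRealSubfield L)))
  (w : PlacesOver L v) (hw : IsCMField.complexConj L • w.1 = w.1) {ϖ : w.1.adicCompletion L}
  (hd : UnramifiedLocalConjDatum (galAdicCompletionMap (L := L) (IsCMField.complexConj L) hw) ϖ)
  (eA : Gqs L v ≃ₜ* ↥(unitaryGroupOfForm (galAdicCompletionMap (L := L) (IsCMField.complexConj L) hw) ((StdForm.antidiagonal 3).over (w.1.adicCompletion L))))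
  (heA : ∀ g : Gqs L v,
    ((eA g : ↥(unitaryGroupOfForm (galAdicCompletionMap (L := L) (IsCMField.complexConj L) hw) ((StdForm.antidiagonal 3).over (w.1.adicCompletion L)))) :
        GL (Fin 3) (w.1.adicCompletion L)) =
      ((localNonsplitEquiv (IsCMField.complexConj L) (qsForm L) (IsCMField.complexConj_ne_one L) w hw g :
        ↥(unitaryGroupOfForm (galAdicCompletionMap (L := L) (IsCMField.complexConj L) hw) (placeForm (qsForm L) w.1))) : GL (Fin 3) (w.1.adicCompletion L)))
  {a : Gqs L v →* ((latticeGraph (galAdicCompletionMap (L := L) (IsCMField.complexConj L) hw) ϖ ((StdForm.antidiagonal 3).over (w.1.adicCompletion L))) ≃g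
    (latticeGraph (galAdicCompletionMap (L := L) (IsCMField.complexConj L) hw) ϖ ((StdForm.antidiagonal 3).over (w.1.adicCompletion L))))}
  (ha : ∀ g, a g = latticeGraphIso (galAdicCompletionMap (L := L) (IsCMField.complexConj L) hw) ϖ ((StdForm.antidiagonal 3).over (w.1.adicCompletion L)) (eA g))
  (A : ℤ → {M : Submodule 𝒪[(w.1.adicCompletion L)] (Fin 3 → (w.1.adicCompletion L)) //
    IsVertex (galAdicCompletionMap (L := L) (IsCMField.complexConj L) hw) ϖ ((StdForm.antidiagonal 3).over (w.1.adicCompletion L)) M})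
  (hA0 : ∀ c : ℤ, (A (2 * c)).1 = latt (Matrix.diagonal ![ϖ ^ c, (1 : w.1.adicCompletion L), ϖ ^ (-c)]))
  (hA1 : ∀ c : ℤ, (A (2 * c + 1)).1 = latt (Matrix.diagonal ![ϖ ^ (c + 1), (1 : w.1.adicCompletion L), ϖ ^ (-c)]))

include hd heA ha hA0 hA1 in
set_option maxHeartbeats 1600000 in  -- statement-level `whnf` on the datum vertex type over the CM carriers (the 41g-H ∕ 48-datum wall), as §3
/-- **(X1v)+(X2) THE VERTEX LETTERS OF ★ 5b AT THE DATUM, ASSEMBLED.**  Given the torus translation `τM` of §2 (`τM · A j = A (j+2)`) and `P₀ = Stab(A 0)` (48-datum's `hP₀` at the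
base edge `d₁ = {A 0, A 1}`): representative ∕ transporter ∕ height functions on VERTICES with `R₀ := A(ℤ)`, `rep₀ := A ∘ idx`, `ht₀ := idx ∕ 2` (floor): `tr₀ b ∈ N(L⁺_v)`,
`rep₀ b ∈ R₀`, `tr₀ b · rep₀ b = b`, `rep₀` is `N`-invariant and the identity on `R₀`, `τM` raises heights of representatives by one and reaches every representative, the compact
torus `C := T ∩ P₀` fixes `R₀` pointwise, and the height-zero representatives are EXACTLY `{A 0, A 1}` — the binders `rep₀ tr₀ htrN₀ hrepR₀ htr₀ hrep_act₀ hrep_id₀ ht₀ hsh₀ hsh₀'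
hCR₀ S₀ hS₀` of ★ `Representation.sum_finrank_block_eigen_eq_of_tree` at `Γ := Gqs L v`, `t := cmBorelTriple L 3 v` (with `hCM` = `inf_le_left`, `hCτ` = ★
`mul_comm_of_mem_cmBorelTriple_M`, `hC` = ★ `isCompact_cmBorelTriple_M_inf`, `hN` = ★ `isLimitOfCompactOpen_cmBorelTriple_N`).
[cite: BruhatTits1972, §10] [cite: Serre1980Trees, II.1.1] [cite: Rogawski1990, §1.10 p. 9; §4.5 p. 45] [cite: Casselman1995, §6.3] -/
theorem exists_horocycleData_vertices (P₀ : Subgroup (Gqs L v)) (hP₀ : ∀ g, g ∈ P₀ ↔ a g (A 0) = A 0)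
    (τM : Gqs L v) (hτA : ∀ j : ℤ, a τM (A j) = A (j + 2)) :
    ∃ (rep₀ : {M : Submodule 𝒪[(w.1.adicCompletion L)] (Fin 3 → (w.1.adicCompletion L)) //
          IsVertex (galAdicCompletionMap (L := L) (IsCMField.complexConj L) hw) ϖ ((StdForm.antidiagonal 3).over (w.1.adicCompletion L)) M} →
        {M : Submodule 𝒪[(w.1.adicCompletion L)] (Fin 3 → (w.1.adicCompletion L)) //
          IsVertex (galAdicCompletionMap (L := L) (IsCMField.complexConj L) hw) ϖ ((StdForm.antidiagonal 3).over (w.1.adicCompletion L)) M})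
      (tr₀ : {M : Submodule 𝒪[(w.1.adicCompletion L)] (Fin 3 → (w.1.adicCompletion L)) //
          IsVertex (galAdicCompletionMap (L := L) (IsCMField.complexConj L) hw) ϖ ((StdForm.antidiagonal 3).over (w.1.adicCompletion L)) M} → Gqs L v)
      (ht₀ : {M : Submodule 𝒪[(w.1.adicCompletion L)] (Fin 3 → (w.1.adicCompletion L)) //
          IsVertex (galAdicCompletionMap (L := L) (IsCMField.complexConj L) hw) ϖ ((StdForm.antidiagonal 3).over (w.1.adicCompletion L)) M} → ℤ),
      (∀ b, tr₀ b ∈ (cmBorelTriple L 3 v : ParabolicTriple (Gqs L v)).N) ∧ (∀ b, rep₀ b ∈ Set.range A) ∧ (∀ b, a (tr₀ b) (rep₀ b) = b) ∧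
      (∀ n : Gqs L v, n ∈ (cmBorelTriple L 3 v : ParabolicTriple (Gqs L v)).N → ∀ b, rep₀ (a n b) = rep₀ b) ∧ (∀ r ∈ Set.range A, rep₀ r = r) ∧
      (∀ r ∈ Set.range A, ht₀ (rep₀ (a τM r)) = ht₀ r + 1) ∧ (∀ r' ∈ Set.range A, ∃ r ∈ Set.range A, rep₀ (a τM r) = r') ∧
      (∀ c : Gqs L v, c ∈ (cmBorelTriple L 3 v : ParabolicTriple (Gqs L v)).M ⊓ P₀ → ∀ r ∈ Set.range A, a c r = r) ∧
      (∀ r, (r ∈ Set.range A ∧ ht₀ r = 0) ↔ (r = A 0 ∨ r = A 1)) := by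
  obtain ⟨idx, tr, htrN, htr, hidxN, hidxA⟩ := exists_horocycleIndex_vertices L v w hw hd eA heA ha A hA0 hA1
  refine ⟨fun b => A (idx b), tr, fun b => idx b / 2, htrN, fun b => ⟨idx b, rfl⟩, htr, fun n hn b => by simp only [hidxN n hn b], ?_, ?_, ?_, ?_, ?_⟩
  · rintro r ⟨j, rfl⟩; simp only [hidxA]
  · rintro r ⟨j, rfl⟩; simp only [hτA, hidxA]; omega
  · rintro r' ⟨j, rfl⟩; exact ⟨A (j - 2), ⟨j - 2, rfl⟩, by simp only [hτA, hidxA, sub_add_cancel]⟩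
  · rintro c hc r ⟨j, rfl⟩
    exact apartmentEnum_eq_self_of_mem_cmBorelTriple_M_of_apply_zero L v w hw hd eA heA ha A hA0 hA1 hc.1 ((hP₀ c).1 hc.2) j
  · intro r
    constructor
    · rintro ⟨⟨j, rfl⟩, h⟩
      simp only [hidxA] at h
      have hj : j = 0 ∨ j = 1 := by omega
      rcases hj with rfl | rfl
      · exact Or.inl rfl
      · exact Or.inr rfl
    · rintro (rfl | rfl)
      · exact ⟨⟨0, rfl⟩, by simp only [hidxA]; norm_num⟩
      · exact ⟨⟨1, rfl⟩, by simp only [hidxA]; norm_num⟩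

include hd heA ha hA0 hA1 in
set_option maxHeartbeats 1600000 in  -- statement-level `whnf` on the datum edge type, as §3
/-- **(X1e)+(X2) THE EDGE LETTERS OF ★ 5b AT THE DATUM, ASSEMBLED** (`act₁ g := (a g).mapEdgeSet`, `R₁ := {A j, A (j+1)}(ℤ)`, `rep₁ := E ∘ idx₁`, `ht₁ := idx₁ ∕ 2`): the binders
`rep₁ tr₁ htrN₁ hrepR₁ htr₁ hrep_act₁ hrep_id₁ ht₁ hsh₁ hsh₁' hCR₁ S₁ hS₁` of ★ `Representation.sum_finrank_block_eigen_eq_of_tree`, with `S₁ = { {A 0, A 1}, {A 1, A 2} }`.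
[cite: BruhatTits1972, §10] [cite: Serre1980Trees, II.1.1] [cite: Rogawski1990, §1.10 p. 9; §4.5 p. 45] [cite: Casselman1995, §6.3] -/
theorem exists_horocycleData_edges (P₀ : Subgroup (Gqs L v)) (hP₀ : ∀ g, g ∈ P₀ ↔ a g (A 0) = A 0)
    (τM : Gqs L v) (hτA : ∀ j : ℤ, a τM (A j) = A (j + 2)) :
    ∃ (rep₁ : (latticeGraph (galAdicCompletionMap (L := L) (IsCMField.complexConj L) hw) ϖ ((StdForm.antidiagonal 3).over (w.1.adicCompletion L))).edgeSet → (latticeGraph (galAdicCompletionMap (L := L) (IsCMField.complexConj L) hw) ϖ ((StdForm.antidiagonal 3).over (w.1.adicCompletion L))).edgeSet) (tr₁ : (latticeGraph (galAdicCompletionMap (L := L) (IsCMField.complexConj L) hw) ϖ ((StdForm.antidiagonal 3).over (w.1.adicCompletion L))).edgeSet → Gqs L v) (ht₁ : (latticeGraph (galAdicCompletionMap (L := L) (IsCMField.complexConj L) hw) ϖ ((StdForm.antidiagonal 3).over (w.1.adicCompletion L))).edgeSet → ℤ),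
      (∀ d, tr₁ d ∈ (cmBorelTriple L 3 v : ParabolicTriple (Gqs L v)).N) ∧
      (∀ d, rep₁ d ∈ (Set.range fun j : ℤ => (⟨s(A j, A (j + 1)), (SimpleGraph.mem_edgeSet _).2 (latticeGraph_adj_apartmentEnum_succ hd A hA0 hA1 j)⟩ : (latticeGraph (galAdicCompletionMap (L := L) (IsCMField.complexConj L) hw) ϖ ((StdForm.antidiagonal 3).over (w.1.adicCompletion L))).edgeSet))) ∧
      (∀ d, (a (tr₁ d)).mapEdgeSet (rep₁ d) = d) ∧
      (∀ n : Gqs L v, n ∈ (cmBorelTriple L 3 v : ParabolicTriple (Gqs L v)).N → ∀ d, rep₁ ((a n).mapEdgeSet d) = rep₁ d) ∧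
      (∀ r ∈ (Set.range fun j : ℤ => (⟨s(A j, A (j + 1)), (SimpleGraph.mem_edgeSet _).2 (latticeGraph_adj_apartmentEnum_succ hd A hA0 hA1 j)⟩ : (latticeGraph (galAdicCompletionMap (L := L) (IsCMField.complexConj L) hw) ϖ ((StdForm.antidiagonal 3).over (w.1.adicCompletion L))).edgeSet)), rep₁ r = r) ∧
      (∀ r ∈ (Set.range fun j : ℤ => (⟨s(A j, A (j + 1)), (SimpleGraph.mem_edgeSet _).2 (latticeGraph_adj_apartmentEnum_succ hd A hA0 hA1 j)⟩ : (latticeGraph (galAdicCompletionMap (L := L) (IsCMField.complexConj L) hw) ϖ ((StdForm.antidiagonal 3).over (w.1.adicCompletion L))).edgeSet)), ht₁ (rep₁ ((a τM).mapEdgeSet r)) = ht₁ r + 1) ∧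
      (∀ r' ∈ (Set.range fun j : ℤ => (⟨s(A j, A (j + 1)), (SimpleGraph.mem_edgeSet _).2 (latticeGraph_adj_apartmentEnum_succ hd A hA0 hA1 j)⟩ : (latticeGraph (galAdicCompletionMap (L := L) (IsCMField.complexConj L) hw) ϖ ((StdForm.antidiagonal 3).over (w.1.adicCompletion L))).edgeSet)), ∃ r ∈ (Set.range fun j : ℤ => (⟨s(A j, A (j + 1)), (SimpleGraph.mem_edgeSet _).2 (latticeGraph_adj_apartmentEnum_succ hd A hA0 hA1 j)⟩ : (latticeGraph (galAdicCompletionMap (L := L) (IsCMField.complexConj L) hw) ϖ ((StdForm.antidiagonal 3).over (w.1.adicCompletion L))).edgeSet)), rep₁ ((a τM).mapEdgeSet r) = r') ∧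
      (∀ c : Gqs L v, c ∈ (cmBorelTriple L 3 v : ParabolicTriple (Gqs L v)).M ⊓ P₀ → ∀ r ∈ (Set.range fun j : ℤ => (⟨s(A j, A (j + 1)), (SimpleGraph.mem_edgeSet _).2 (latticeGraph_adj_apartmentEnum_succ hd A hA0 hA1 j)⟩ : (latticeGraph (galAdicCompletionMap (L := L) (IsCMField.complexConj L) hw) ϖ ((StdForm.antidiagonal 3).over (w.1.adicCompletion L))).edgeSet)), (a c).mapEdgeSet r = r) ∧
      (∀ r, (r ∈ (Set.range fun j : ℤ => (⟨s(A j, A (j + 1)), (SimpleGraph.mem_edgeSet _).2 (latticeGraph_adj_apartmentEnum_succ hd A hA0 hA1 j)⟩ : (latticeGraph (galAdicCompletionMap (L := L) (IsCMField.complexConj L) hw) ϖ ((StdForm.antidiagonal 3).over (w.1.adicCompletion L))).edgeSet)) ∧ ht₁ r = 0) ↔ (r = (⟨s(A 0, A (0 + 1)), (SimpleGraph.mem_edgeSet _).2 (latticeGraph_adj_apartmentEnum_succ hd A hA0 hA1 0)⟩ : (latticeGraph (galAdicCompletionMap (L := L) (IsCMField.complexConj L) hw) ϖ ((StdForm.antidiagonal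 3).over (w.1.adicCompletion L))).edgeSet) ∨ r = (⟨s(A 1, A (1 + 1)), (SimpleGraph.mem_edgeSet _).2 (latticeGraph_adj_apartmentEnum_succ hd A hA0 hA1 1)⟩ : (latticeGraph (galAdicCompletionMap (L := L) (IsCMField.complexConj L) hw) ϖ ((StdForm.antidiagonal 3).over (w.1.adicCompletion L))).edgeSet))) := by
  obtain ⟨idx₁, tr₁, htrN₁, htr₁, hidxN₁, hidxA₁⟩ := exists_horocycleIndex_edges L v w hw hd eA heA ha A hA0 hA1
  -- the torus translation on apartment edges
  have hτE : ∀ j : ℤ, (a τM).mapEdgeSet (⟨s(A j, A (j + 1)), (SimpleGraph.mem_edgeSet _).2 (latticeGraph_adj_apartmentEnum_succ hd A hA0 hA1 j)⟩ : (latticeGraph (galAdicCompletionMap (L := L) (IsCMField.complexConj L) hw) ϖ ((StdForm.antidiagonal 3).over (w.1.adicCompletion L))).edgeSet) = (⟨s(A (j + 2), A ((j + 2) + 1)), (SimpleGraph.mem_edgeSet _).2 (latticeGraph_adj_apartmentEnum_succ hd A hA0 hA1 (j + 2))⟩ : (latticeGraph (galAdicCompletionMap (L := L) (IsCMField.complexConj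 L) hw) ϖ ((StdForm.antidiagonal 3).over (w.1.adicCompletion L))).edgeSet) := fun j => by
    apply Subtype.ext
    change Sym2.map (a τM) s(A j, A (j + 1)) = s(A (j + 2), A (j + 2 + 1))
    rw [Sym2.map_mk, hτA, hτA, show j + 1 + 2 = j + 2 + 1 by ring]
  refine ⟨fun d => (⟨s(A (idx₁ d), A ((idx₁ d) + 1)), (SimpleGraph.mem_edgeSet _).2 (latticeGraph_adj_apartmentEnum_succ hd A hA0 hA1 (idx₁ d))⟩ : (latticeGraph (galAdicCompletionMap (L := L) (IsCMField.complexConj L) hw) ϖ ((StdForm.antidiagonal 3).over (w.1.adicCompletion L))).edgeSet), tr₁, fun d => idx₁ d / 2, htrN₁, fun d => ⟨idx₁ d, rfl⟩, htr₁, fun n hn d => by simp only [hidxN₁ n hn d], ?_, ?_, ?_, ?_, ?_⟩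
  · rintro r ⟨j, rfl⟩
    simp only [hidxA₁]
  · rintro r ⟨j, rfl⟩
    simp only [hτE, hidxA₁]
    omega
  · rintro r' ⟨j, rfl⟩
    refine ⟨(⟨s(A (j - 2), A ((j - 2) + 1)), (SimpleGraph.mem_edgeSet _).2 (latticeGraph_adj_apartmentEnum_succ hd A hA0 hA1 (j - 2))⟩ : (latticeGraph (galAdicCompletionMap (L := L) (IsCMField.complexConj L) hw) ϖ ((StdForm.antidiagonal 3).over (w.1.adicCompletion L))).edgeSet), ⟨j - 2, rfl⟩, ?_⟩
    simp only [hτE, hidxA₁, sub_add_cancel]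
  · rintro c hc r ⟨j, rfl⟩
    exact mapEdgeSet_apartmentEnum_eq_self_of_mem_cmBorelTriple_M_of_apply_zero L v w hw hd eA heA ha A hA0 hA1 hc.1 ((hP₀ c).1 hc.2) j
  · intro r
    constructor
    · rintro ⟨⟨j, rfl⟩, h⟩
      simp only [hidxA₁] at h
      have hj : j = 0 ∨ j = 1 := by omega
      rcases hj with rfl | rfl
      · exact Or.inl rfl
      · exact Or.inr rfl
    · rintro (rfl | rfl)
      · exact ⟨⟨0, rfl⟩, by simp only [hidxA₁]; rfl⟩
      · exact ⟨⟨1, rfl⟩, by simp only [hidxA₁]; rfl⟩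

end Package

end Summit.HodgeConjecture.HodgeConjecture.Cruxes.H413.F0P3cStCharTSHorocyclesAtDatum

end
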